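import Summits.QuantumFields.YangMills.Theorems.BalabanLadderIRcofEquipartitionSeamSpectralDictClauses
import HarnessLib

/-!
# Crux `IRcof` (stmt-QuantumFields-26930) · line `equipartition_seam` (row 47) · located stub L `SpectralDict.SliceRealisationV` —
# the REAL → COMPLEX positive-type bridge `complexPosType_of_real` (helper; LEAD prover ym-ir-line-ab-p1 g8 on critic ym-ir-crit-3 g6's ask, bus l.≈1795)

SOURCE OF RECORD: `Cruxes/IRcof/Lines/equipartition_seam_SpectralDict.lean` rev 2 (crux write b62f94c5b881; author ideator ym-ir-idea-22 g7),
§7 l.1181–1256 VERBATIM: `integrable_realSection`, `integrable_integral_realSection`, `complexPosType_of_real`.  WHY: the landed text of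
L (`Theorems/…SpectralDict.lean`, p696729 = rev 1 of the workfile) states the positive-type clause in the COMPLEX test-function form
`∀ f : X → ℂ, Measurable f → (∀ x, ‖f x‖ ≤ 1) → 0 ≤ (∫∫ conj (f x) * K x y * f y).re`, while the slice-kernel packages
(`SliceKernel.slicePackage` ∕ `zPackage_of_twistSplitWeight`) deliver the REAL form `∀ φ : X → ℝ, Measurable φ → (∀ x, |φ x| ≤ 1) →
0 ≤ ∫∫ φ x * K x y * φ y`; this file is the 77-line step between them, BY NAME, so that no prover of L re-derives it (critic's
bookkeeping note: the two forms are equivalent for a real bounded kernel; rev 9 of the skeleton stays).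

HONEST FRAMING.  Elementary measure theory (Fubini ∕ integrability of bounded sections, `Re ∬ conj(u+iv) K (u′+iv′) = ∬ uKu′ + ∬ vKv′`);
proves no located stub; six located stubs of row 47 open; class PWP, mechanism 0, width 0; `IRcof` ∕ `IR` 0∕1; the Yang–Mills mass gap
(Clay) is NOT proved by anything in this tree; R4 closes only the conditional finite-𝕋⁴ rung `BalabanLadder.UV`.
-/

noncomputable section

open MeasureTheory Filter Function Topology
open scoped InnerProductSpace ComplexConjugate ENNReal
open Literature.Analysis.OperatorTheory

namespace Summit.QuantumFields.YangMills.Cruxes.IRcof.EquipartitionSeam.SpectralDict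

variable {X : Type*} [MeasurableSpace X] {μ : Measure X}

section RealPosType

variable [IsFiniteMeasure μ]

/-- Sections of a bounded real kernel against bounded measurable real test functions are integrable. -/
theorem integrable_realSection {Kr : X → X → ℝ} {C : ℝ} (hK : StronglyMeasurable (uncurry Kr))
    (hC : ∀ x y, ‖Kr x y‖ ≤ C) {p q : X → ℝ} (hq : Measurable q) (hp1 : ∀ x, |p x| ≤ 1)
    (hq1 : ∀ x, |q x| ≤ 1) (x : X) : Integrable (fun y => p x * Kr x y * q y) μ := by
  refine Integrable.of_bound
    ((measurable_const.mul (hK.of_uncurry_left (x := x)).measurable).mul hq).aestronglyMeasurable (max C 0)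
    (Eventually.of_forall fun y => ?_)
  rw [norm_mul, norm_mul, Real.norm_eq_abs, Real.norm_eq_abs (q y)]
  calc |p x| * ‖Kr x y‖ * |q y| ≤ 1 * max C 0 * 1 :=
        mul_le_mul (mul_le_mul (hp1 x) ((hC x y).trans (le_max_left _ _)) (norm_nonneg _) zero_le_one)
          (hq1 y) (abs_nonneg _) (by positivity)
    _ = max C 0 := by ring

/-- … and so are their integrals as functions of the outer variable. -/
theorem integrable_integral_realSection {Kr : X → X → ℝ} {C : ℝ} (hK : StronglyMeasurable (uncurry Kr))
    (hC : ∀ x y, ‖Kr x y‖ ≤ C) {p q : X → ℝ} (hp : Measurable p) (hq : Measurable q) (hp1 : ∀ x, |p x| ≤ 1)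
    (hq1 : ∀ x, |q x| ≤ 1) : Integrable (fun x => ∫ y, p x * Kr x y * q y ∂μ) μ := by
  have hG : StronglyMeasurable fun x => ∫ y, Kr x y * q y ∂μ := by
    have h2 : StronglyMeasurable fun z : X × X => uncurry Kr z * q z.2 :=
      hK.mul (hq.comp measurable_snd).stronglyMeasurable
    simpa [uncurry] using h2.integral_prod_right'
  have heq : (fun x => ∫ y, p x * Kr x y * q y ∂μ) = fun x => p x * ∫ y, Kr x y * q y ∂μ := by
    funext x; simp_rw [mul_assoc]; exact integral_const_mul _ _
  rw [heq]
  refine Integrable.of_bound (hp.stronglyMeasurable.mul hG).aestronglyMeasurable (1 * (max C 0 * μ.real Set.univ))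
    (Eventually.of_forall fun x => ?_)
  rw [norm_mul, Real.norm_eq_abs]
  refine mul_le_mul (hp1 x) (norm_integral_le_of_norm_le_const (Eventually.of_forall fun y => ?_))
    (norm_nonneg _) zero_le_one
  rw [norm_mul, Real.norm_eq_abs (q y)]
  calc ‖Kr x y‖ * |q y| ≤ max C 0 * 1 :=
        mul_le_mul ((hC x y).trans (le_max_left _ _)) (hq1 y) (abs_nonneg _) (by positivity)
    _ = max C 0 := mul_one _

/-- **Real positive type implies complex positive type** for a real kernel: `Re ∬ conj f · K · f = ∬ uKu + ∬ vKv`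
with `u = Re f`, `v = Im f`. -/
theorem complexPosType_of_real {Kr : X → X → ℝ} {C : ℝ} (hK : StronglyMeasurable (uncurry Kr))
    (hC : ∀ x y, ‖Kr x y‖ ≤ C)
    (hreal : ∀ φ : X → ℝ, Measurable φ → (∀ x, |φ x| ≤ 1) → 0 ≤ ∫ x, ∫ y, φ x * Kr x y * φ y ∂μ ∂μ)
    (f : X → ℂ) (hf : Measurable f) (hf1 : ∀ x, ‖f x‖ ≤ 1) :
    0 ≤ (∫ x, ∫ y, conj (f x) * ((Kr x y : ℝ) : ℂ) * f y ∂μ ∂μ).re := by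
  set u : X → ℝ := fun x => (f x).re with hu_def
  set v : X → ℝ := fun x => (f x).im with hv_def
  have hu : Measurable u := Complex.measurable_re.comp hf
  have hv : Measurable v := Complex.measurable_im.comp hf
  have hu1 : ∀ x, |u x| ≤ 1 := fun x => (Complex.abs_re_le_norm _).trans (hf1 x)
  have hv1 : ∀ x, |v x| ≤ 1 := fun x => (Complex.abs_im_le_norm _).trans (hf1 x)
  -- pointwise decomposition of the integrand
  have hpt : ∀ x y, conj (f x) * ((Kr x y : ℝ) : ℂ) * f y =
      (((u x * Kr x y * u y + v x * Kr x y * v y : ℝ) : ℂ)) +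
        Complex.I * (((u x * Kr x y * v y - v x * Kr x y * u y : ℝ) : ℂ)) := by
    intro x y
    (apply Complex.ext <;> simp [hu_def, hv_def, Complex.mul_re, Complex.mul_im]); ring
  -- inner integrals
  have hin : ∀ x, (∫ y, conj (f x) * ((Kr x y : ℝ) : ℂ) * f y ∂μ) =
      (((∫ y, u x * Kr x y * u y ∂μ) + (∫ y, v x * Kr x y * v y ∂μ) : ℝ) : ℂ) +
        Complex.I * (((∫ y, u x * Kr x y * v y ∂μ) - (∫ y, v x * Kr x y * u y ∂μ) : ℝ) : ℂ) := by
    intro x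
    have i1 := integrable_realSection (μ := μ) hK hC (p := u) hu hu1 hu1 x
    have i2 := integrable_realSection (μ := μ) hK hC (p := v) hv hv1 hv1 x
    have i3 := integrable_realSection (μ := μ) hK hC (p := u) hv hu1 hv1 x
    have i4 := integrable_realSection (μ := μ) hK hC (p := v) hu hv1 hu1 x
    simp_rw [hpt x]
    rw [integral_add (i1.add i2).ofReal ((i3.sub i4).ofReal.const_mul _), integral_const_mul,
      integral_complex_ofReal, integral_complex_ofReal, integral_add i1 i2, integral_sub i3 i4]
  -- outer integral
  have o1 := integrable_integral_realSection (μ := μ) hK hC hu hu hu1 hu1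
  have o2 := integrable_integral_realSection (μ := μ) hK hC hv hv hv1 hv1
  have o3 := integrable_integral_realSection (μ := μ) hK hC hu hv hu1 hv1
  have o4 := integrable_integral_realSection (μ := μ) hK hC hv hu hv1 hu1
  simp_rw [hin]
  rw [integral_add (o1.add o2).ofReal ((o3.sub o4).ofReal.const_mul _), integral_const_mul,
    integral_complex_ofReal, integral_complex_ofReal, integral_add o1 o2]
  simp only [Complex.add_re, Complex.ofReal_re, Complex.mul_re, Complex.I_re, Complex.I_im, Complex.ofReal_im,
    zero_mul, one_mul, sub_zero, add_zero]
  exact add_nonneg (hreal u hu hu1) (hreal v hv hv1)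

end RealPosType

end Summit.QuantumFields.YangMills.Cruxes.IRcof.EquipartitionSeam.SpectralDict

end
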